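import Summits.ABC.IUTFork.Thm311RealInd1StripBaseUnitsOdd
import Summits.ABC.IUTFork.Thm311RealInd1StripTwistJWPlanes
import Summits.ABC.IUTFork.Thm311RealIsmDHMoverInitialThetaDataK
import Summits.ABC.IUTFork.Cor312ProvKRamified
import HarnessLib

/-!
# [IUTchIII] Thm 3.11 (i) (Ind1): print's (Ind1) STRIP PART at the BAD PLACES of a GENUINE initial Θ-datum ([IUTchI] Def 3.1) — the
# hypotheses `p odd`, `e(w|p) ≥ 3`, `[K_w : ℚ_p] ≥ 3` of the statements of record are DISCHARGED there; only the Jannsen–Wingberg named fact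
# (and, for the ball movers, the parity of `f(w|p)`) remains

PROOF-ONLY file (abc-iut cell, Cor. 3.12 sub-crew, seat abc-iut-c312-1 = holder of record of the typed [IUTchIII] Thm. 3.11,
gen 13; row «R16 (Ind1)-STRIP AT GENUINE BAD PLACES» — the junction of the (Ind1)-strip lineage R9–R15 with abc-iut-L5-t2's FAITHFUL
`Literature.IUT.HodgeTheaters.InitialThetaData` and abc-iut-C-cert-3's `K`-level Dupuy–Hilado pilot datum `Cor312Prov.pilotDataOfK D K`).
TAKES NO SIDE on [IUTchIII] Cor. 3.12.

The statements of record of the (Ind1)-strip lineage (gen 8–13) are stated at an arbitrary finite place `v ∣ p` of a number field with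
side conditions — `p` odd; `[K_v : ℚ_p] ≥ 3` (infinite strip part, realised planes); `e(v|p) ≥ 3` and `f(v|p)` odd (window movers,
index `≥ p`); `[K_v : ℚ_p]` even / odd (base line).  [IUTchI] Def. 3.1 makes all but the parity of `f` AUTOMATIC at the places where the
Θ-link lives — the bad places `w ∈ 𝕍(K)` over `𝕍^bad_mod` of the field `K = F(E_F[l])` of an initial Θ-datum `D = (F/F̄, X_F, l, C_K, 𝕍, 𝕍^bad_mod, ε)`:
* `Real.residueChar_ne_two_of_mem_S_pilotDataOfK` — `p_w ≠ 2` (Def. 3.1 (b) «of odd residue characteristic», abc-iut-w5-d039's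
  `not_mem_pilotDataOfK_S_of_two_mem`);
* `Real.five_le_ramificationIdx_of_mem_S_pilotDataOfK` / `Real.five_le_localDeg_of_mem_S_pilotDataOfK` — `e(w|p) ≥ l ≥ 5` and hence
  `[K_w : ℚ_p] = e·f ≥ 5` (Def. 3.1 (c) «`l` is prime to … the orders of the `q`-parameters», read backwards through [IUTchI] Ex. 3.2 (iv)
  `2l ∣ ord_w(q)`: abc-iut-w5-d054's `l_le_ramificationIdx_int_of_over_VFbad`, `D.five_le_l`).
CONSEQUENCES (modulo the GROUP-level named fact `JannsenWingbergTwists`, Jannsen–Wingberg 1982 / NSW 7.5.14 / Hoshi–Nishio 2022 / Kondo 2025,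
displayed as the binder `hJW`; NO other hypothesis on the place):
* **`Real.ind1StripOf_infinite_of_mem_S_pilotDataOfK`** — at EVERY bad place `w` of `K`, print's (Ind1) strip part
  `Real.ind1StripOf w (Real.galoisLog w)` is INFINITE (gen 11 p496033 at `[K_w : ℚ_p] ≥ 3`) — versus Dupuy–Hilado's strip slot
  `Real.stripAutDH = {1}` (§4.7); carrier form `Real.ind1Strip_infinite_of_mem_S_pilotDataOfK`;
* **`Real.exists_mem_ind1StripOf_mapsOut_closedBall_of_mem_S_pilotDataOfK`** / `Real.exists_prime_le_relIndex_of_mem_S_pilotDataOfK` — at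
  every bad place `w` with `f(w|p)` ODD, every window of `e(w|p) + 1` consecutive ideal-shaped regions `𝔪_w^m` contains one that some strip
  automorphism STRICTLY INFLATES, with index `≥ p` (gen 10/11 p481941/p484887/p493616 at `e ≥ 3`);
* **`Real.baseLine_at_bad_of_jannsenWingberg`** — the base line `ℚ_p·1 ⊆ K_w` at a bad place: moved off itself if `[K_w : ℚ_p]` is even
  (gen 12, `JannsenWingbergTwistsFirst`), the gen-13 dichotomy if odd (`[K_w : ℚ_p] = 1` does not occur: `≥ 5`).
Reading for the record (neutral, OUR typed objects): at the bad places of a genuine initial Θ-datum — the only places where [IUTchIII]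
Cor. 3.12's Θ-pilot regions live — print's (Ind1) strip part is never Dupuy–Hilado's `{1}` (modulo the Jannsen–Wingberg structure theorem)
and, where `f(w|p)` is odd, strictly inflates ideal-shaped regions in every window; its inflation stays bounded by the fixed factor `C_w`
(gen 10 p485448, unconditional) and sideways (trace-preserving, gen 11 p494948).  HONEST SCOPE: conditional on `hJW`; the parity of
`f(w|p)` and the `v`-adic shape of the Jannsen–Wingberg basis are not pinned by [IUTchI] Def. 3.1; nothing here asserts or refutes
[IUTchIII] Cor. 3.12; NO abc claim.  [claim: Mochizuki2012, status: disputed] ([IUTchI] Def. 3.1 (b),(c) pp. 61–62, Ex. 3.2 (iv) p. 71;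
[IUTchIII] Thm. 3.11 (i) p. 154); [cite: JannsenWingberg1982, Thm 2 p.75 and §5.1 p.96]; [cite: Kondo2025OuterAutMLF, §2 Thm 2.1, proof of
Thm 2.3 p.10]; [cite: HoshiNishio2022OuterAutMLF, Thm 1.5, Cor 1.6 (i)]; [cite: DupuyHilado2025, §3.3, §4.7]; [cite: NeukirchANT1999, Ch. II
Prop. (6.8)].  typed ≠ proved; a conditional theorem discharges nothing it binds.
-/

set_option autoImplicit false

noncomputable section

open Metric Set
open scoped Pointwise

namespace Summit.ABC.IUTFork.Thm311.Real

open NumberField IsDedekindDomain Literature.NumberTheory.NumberFields Literature.IUT.LogVolume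
open Literature.NumberTheory.GaloisRepresentations Literature.NumberTheory.GaloisRepresentations.Ultrametric
open Literature.AnabelianGeometry.AbsoluteAnabelian Literature.IUT.HodgeArakelov Literature.IUT.HodgeTheaters
open Literature.IUT.HodgeArakelov.AbsTopMonoids Cor312Prov

variable {F K Fbar : Type} [Field F] [NumberField F] [Field K] [NumberField K] [Algebra F K] [Field Fbar]
  [Algebra F Fbar] [Algebra K Fbar] {E : WeierstrassCurve F} [E.IsElliptic] {l : ℕ} {Pb : BadPlacePredicates K}
  (D : InitialThetaData F K Fbar E l Pb)

/-! ## 1. [IUTchI] Def 3.1 at a bad place of `K`: `p ≠ 2`, `e(w|p) ≥ 5`, `[K_w : ℚ_p] ≥ 5` -/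

/-- **`p_w ≠ 2` at a bad place** of the `K`-level pilot datum of an initial Θ-datum: a rational prime `p` under `w ∈ S` is not `2`
([IUTchI] Def. 3.1 (b) «𝕍^bad_mod … of odd residue characteristic»; abc-iut-w5-d039 `not_mem_pilotDataOfK_S_of_two_mem`).
[claim: Mochizuki2012, status: disputed] [cite: DupuyHilado2025, §3.3] -/
theorem residueChar_ne_two_of_mem_S_pilotDataOfK {w : HeightOneSpectrum (𝓞 K)} (hS : w ∈ (pilotDataOfK D K).S)
    {p : ℕ} (hw : ((p : ℕ) : 𝓞 K) ∈ w.asIdeal) : p ≠ 2 := by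
  rintro rfl
  exact not_mem_pilotDataOfK_S_of_two_mem D K hw hS

/-- **`5 ≤ l ≤ e(w|p)` at a bad place** ([IUTchI] Def. 3.1 (c): `l ≥ 5` prime to `ord_v(q_v)`, and `2l ∣ ord_w(q) = e(w|v)·ord_v(q_v)` by
Ex. 3.2 (iv), so `l ∣ e(w|v) ∣ e(w|p)`; abc-iut-w5-d054 `l_le_ramificationIdx_int_of_over_VFbad`). [claim: Mochizuki2012, status: disputed]
[cite: NeukirchANT1999, Ch. II Prop. (6.8)] -/
theorem five_le_ramificationIdx_of_mem_S_pilotDataOfK {w : HeightOneSpectrum (𝓞 K)} (hS : w ∈ (pilotDataOfK D K).S) :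
    5 ≤ w.asIdeal.ramificationIdx ℤ :=
  D.five_le_l.trans (l_le_ramificationIdx_int_of_over_VFbad D w ((mem_pilotDataOfK_S_iff D K w).mp hS))

/-- **`[K_w : ℚ_p] = e(w|p)·f(w|p) ≥ 5` at a bad place** (so in particular `≥ 3`, `≥ 2`, and `≠ 1`). [claim: Mochizuki2012, status: disputed]
[cite: NeukirchANT1999, Ch. II Prop. (6.8)] -/
theorem five_le_localDeg_of_mem_S_pilotDataOfK {w : HeightOneSpectrum (𝓞 K)} (hS : w ∈ (pilotDataOfK D K).S) :
    5 ≤ localDeg K w :=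
  (five_le_ramificationIdx_of_mem_S_pilotDataOfK D hS).trans
    (Nat.le_mul_of_pos_right _ (Ideal.inertiaDeg_pos _ _))

/-! ## 2. The strip part is INFINITE at every bad place (modulo `JannsenWingbergTwists`) -/

/-- **PRINT'S (Ind1) STRIP PART IS INFINITE AT EVERY BAD PLACE OF A GENUINE INITIAL Θ-DATUM**, modulo `JannsenWingbergTwists`: for
every initial Θ-datum `D` ([IUTchI] Def. 3.1, abc-iut-L5-t2's faithful structure) and every place `w` of `K = F(E_F[l])` in the bad set of the
`K`-level Dupuy–Hilado pilot datum, `Real.ind1StripOf w (Real.galoisLog w)` — the automorphisms of `K_w` induced through THE equivariant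
lift by the topological automorphisms of `G_w` — is an INFINITE set (gen 11's `ind1StripOf_infinite_of_jannsenWingberg` at `[K_w : ℚ_p] ≥ 3`;
here `p ≠ 2` and `[K_w : ℚ_p] ≥ 5` come from Def. 3.1).  Dupuy–Hilado's strip slot at the same place is `{1}` (§4.7).
[claim: Mochizuki2012, status: disputed] [cite: HoshiNishio2022OuterAutMLF, Thm 1.5, Cor 1.6 (i)] [cite: DupuyHilado2025, §4.7] -/
theorem ind1StripOf_infinite_of_mem_S_pilotDataOfK (hJW : JannsenWingbergTwists)
    {w : HeightOneSpectrum (𝓞 K)} (hS : w ∈ (pilotDataOfK D K).S) :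
    (ind1StripOf w (galoisLog w)).Infinite := by
  haveI : Fact (closureAt w).residueChar.Prime := (closureAt w).fact_residueChar_prime
  have hw := natCast_residueChar_closureAt_mem w
  exact ind1StripOf_infinite_of_jannsenWingberg w hJW (closureAt w).residueChar hw
    (residueChar_ne_two_of_mem_S_pilotDataOfK D hS hw)
    ((show 3 ≤ 5 by norm_num).trans (five_le_localDeg_of_mem_S_pilotDataOfK D hS))

/-- **Carrier form** (abc-iut-c312-5's `ℚ`-linear slot `Real.ind1Strip (analyticLogv K) w` of the print signature `Real.logShellsPrint`):
INFINITE at every bad place — while `Real.stripAutDH (.inr w) = {1}` is a singleton. [claim: Mochizuki2012, status: disputed]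
[cite: DupuyHilado2025, §4.7] -/
theorem ind1Strip_infinite_of_mem_S_pilotDataOfK (hJW : JannsenWingbergTwists)
    {w : HeightOneSpectrum (𝓞 K)} (hS : w ∈ (pilotDataOfK D K).S) :
    (ind1Strip (analyticLogv K) w).Infinite ∧ (stripAutDH (.inr w : Place K)).Finite := by
  haveI : Fact (closureAt w).residueChar.Prime := (closureAt w).fact_residueChar_prime
  have hw := natCast_residueChar_closureAt_mem w
  exact ⟨ind1Strip_infinite_of_jannsenWingberg w hJW (closureAt w).residueChar hw
      (residueChar_ne_two_of_mem_S_pilotDataOfK D hS hw)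
      ((show 3 ≤ 5 by norm_num).trans (five_le_localDeg_of_mem_S_pilotDataOfK D hS)),
    Set.finite_singleton _⟩

/-! ## 3. Window movers at the bad places with `f(w|p)` odd (modulo `JannsenWingbergTwists`) -/

/-- **WINDOW MOVERS AT THE BAD PLACES**, modulo `JannsenWingbergTwists`: at every bad place `w` of `K` whose residue degree `f(w|p)` is ODD,
for every `k ∈ ℤ` some `χ ∈ Real.ind1StripOf w (Real.galoisLog w)` carries a point of some `𝔪_w^m = B(0, ‖ϖ‖^m)`, `k ≤ m ≤ k + e(w|p)`, OUT
of `𝔪_w^m` (gen 11's `exists_mem_ind1StripOf_galoisLog_mapsOut_closedBall_of_jannsenWingberg_odd`; `p ≠ 2` and `e(w|p) ≥ 3` discharged by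
[IUTchI] Def. 3.1 (b),(c)). [claim: Mochizuki2012, status: disputed] [cite: JannsenWingberg1982, §5.1 p.96]
[cite: Kondo2025OuterAutMLF, §2 proof of Thm 2.3 p.10] -/
theorem exists_mem_ind1StripOf_mapsOut_closedBall_of_mem_S_pilotDataOfK (hJW : JannsenWingbergTwists)
    {w : HeightOneSpectrum (𝓞 K)} (hS : w ∈ (pilotDataOfK D K).S)
    (p : ℕ) [Fact p.Prime] (hw : ((p : ℕ) : 𝓞 K) ∈ w.asIdeal) (hf : Odd (w.asIdeal.inertiaDeg ℤ))
    {ϖ : (RescaledCompletion K p w hw)ˣ} (hϖ : IsUniformizer ϖ) (k : ℤ) :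
    ∃ χ ∈ ind1StripOf w (galoisLog w), ∃ m : ℤ, k ≤ m ∧ m ≤ k + w.asIdeal.ramificationIdx ℤ ∧
      ∃ x ∈ closedBall (0 : RescaledCompletion K p w hw) (‖(ϖ : RescaledCompletion K p w hw)‖ ^ m),
        RescaledCompletion.of K p w hw (χ ((RescaledCompletion.of K p w hw).symm x)) ∉
          closedBall (0 : RescaledCompletion K p w hw) (‖(ϖ : RescaledCompletion K p w hw)‖ ^ m) :=
  exists_mem_ind1StripOf_galoisLog_mapsOut_closedBall_of_jannsenWingberg_odd w hJW p hw
    (residueChar_ne_two_of_mem_S_pilotDataOfK D hS hw) hf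
    ((show 3 ≤ 5 by norm_num).trans (five_le_ramificationIdx_of_mem_S_pilotDataOfK D hS)) hϖ k

/-- **INDEX CURRENCY AT THE BAD PLACES**, modulo `JannsenWingbergTwists`: at every bad place `w` with `f(w|p)` odd, every window of
`e(w|p) + 1` consecutive ideal-shaped regions `𝔪_w^m` contains one with `p ≤ [𝔪_w^m ⊔ χ(𝔪_w^m) : 𝔪_w^m]` for some strip automorphism `χ`
(gen 11's `exists_prime_le_relIndex_of_jannsenWingberg_odd`; Haar: log-volume gain `≥ log p` un-normalised).
[claim: Mochizuki2012, status: disputed] [cite: JannsenWingberg1982, §5.1 p.96] [cite: Kondo2025OuterAutMLF, §2 proof of Thm 2.3 p.10] -/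
theorem exists_prime_le_relIndex_of_mem_S_pilotDataOfK (hJW : JannsenWingbergTwists)
    {w : HeightOneSpectrum (𝓞 K)} (hS : w ∈ (pilotDataOfK D K).S)
    (p : ℕ) [Fact p.Prime] (hw : ((p : ℕ) : 𝓞 K) ∈ w.asIdeal) (hf : Odd (w.asIdeal.inertiaDeg ℤ))
    {ϖ : (RescaledCompletion K p w hw)ˣ} (hϖ : IsUniformizer ϖ) (k : ℤ) :
    ∃ χ ∈ ind1StripOf w (galoisLog w), ∃ m : ℤ, k ≤ m ∧ m ≤ k + w.asIdeal.ramificationIdx ℤ ∧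
      p ≤ ((piBall (ϖ ^ m) : OpenAddSubgroup (RescaledCompletion K p w hw)).toAddSubgroup).relIndex
        ((piBall (ϖ ^ m) : OpenAddSubgroup (RescaledCompletion K p w hw)).toAddSubgroup ⊔
          ((piBall (ϖ ^ m) : OpenAddSubgroup (RescaledCompletion K p w hw)).toAddSubgroup).map
            (AddEquiv.toAddMonoidHom
              (((RescaledCompletion.of K p w hw).symm.toAddEquiv.trans
                (χ.trans (RescaledCompletion.of K p w hw).toAddEquiv))))) :=
  exists_prime_le_relIndex_of_jannsenWingberg_odd w hJW p hw (residueChar_ne_two_of_mem_S_pilotDataOfK D hS hw) hf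
    ((show 3 ≤ 5 by norm_num).trans (five_le_ramificationIdx_of_mem_S_pilotDataOfK D hS)) hϖ k

/-! ## 4. The base line at the bad places -/

/-- **THE BASE LINE `ℚ_p·1 ⊆ K_w` AT A BAD PLACE**: `[K_w : ℚ_p] ≥ 5`, so only the even and the odd-`≥ 3` regimes occur —
* `[K_w : ℚ_p]` EVEN (modulo `JannsenWingbergTwistsFirst`): some `ψ ∈ Real.ind1StripOf w (Real.galoisLog w)` does NOT map `ℚ_p·1` into itself
  (gen 12, Kondo Lemma 2.5 (1) / Hoshi–Nishio Lemma 2.4);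
* `[K_w : ℚ_p]` ODD (modulo `JannsenWingbergTwists`): the gen-13 dichotomy — moved off itself, or the base line is the residual line of a
  realised Jannsen–Wingberg basis whose `2g = [K_w : ℚ_p] − 1` plane transvections are all in the strip part (Kondo: open which).
[claim: Mochizuki2012, status: disputed] [cite: Kondo2025OuterAutMLF, §1 p.5, §2 Lemma 2.5 (1), Remark p.12]
[cite: HoshiNishio2022OuterAutMLF, Def 2.1 (i), Lemma 2.4 p.8] -/
theorem baseLine_at_bad_of_jannsenWingberg (hJW : JannsenWingbergTwists) (hJW₁ : JannsenWingbergTwistsFirst)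
    {w : HeightOneSpectrum (𝓞 K)} (hS : w ∈ (pilotDataOfK D K).S)
    (p : ℕ) [Fact p.Prime] (hw : ((p : ℕ) : 𝓞 K) ∈ w.asIdeal) :
    localDeg K w ≠ 1 ∧
    (Even (localDeg K w) →
      ∃ ψ : w.adicCompletion K ≃+ w.adicCompletion K, ψ ∈ ind1StripOf w (galoisLog w) ∧
        ¬ Set.MapsTo (fun x => RescaledCompletion.of K p w hw (ψ ((RescaledCompletion.of K p w hw).symm x)))
            (Set.range (algebraMap ℚ_[p] (RescaledCompletion K p w hw)))
            (Set.range (algebraMap ℚ_[p] (RescaledCompletion K p w hw)))) ∧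
    (Odd (localDeg K w) →
      (∃ ψ : w.adicCompletion K ≃+ w.adicCompletion K, ψ ∈ ind1StripOf w (galoisLog w) ∧
        ¬ Set.MapsTo (fun x => RescaledCompletion.of K p w hw (ψ ((RescaledCompletion.of K p w hw).symm x)))
            (Set.range (algebraMap ℚ_[p] (RescaledCompletion K p w hw)))
            (Set.range (algebraMap ℚ_[p] (RescaledCompletion K p w hw)))) ∨
      (∃ (g : ℕ) (_ : localDeg K w = 1 + 2 * g) (y : Module.Basis (Fin 1 ⊕ Fin g × Fin 2) ℚ_[p] (RescaledCompletion K p w hw))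
        (ψ ψ' : Fin g → (w.adicCompletion K ≃+ w.adicCompletion K)),
        (∀ i, ψ i ∈ ind1StripOf w (galoisLog w)) ∧ (∀ i, ψ' i ∈ ind1StripOf w (galoisLog w)) ∧
        (∀ i (x : RescaledCompletion K p w hw),
          RescaledCompletion.of K p w hw (ψ i ((RescaledCompletion.of K p w hw).symm x)) =
            x + y.coord (Sum.inr (i, 1)) x • y (Sum.inr (i, 0))) ∧
        (∀ i (x : RescaledCompletion K p w hw),
          RescaledCompletion.of K p w hw (ψ' i ((RescaledCompletion.of K p w hw).symm x)) =
            x - y.coord (Sum.inr (i, 0)) x • y (Sum.inr (i, 1))) ∧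
        Submodule.span ℚ_[p] (Set.range fun iε : Fin g × Fin 2 => y (Sum.inr iε)) =
          LinearMap.ker (Algebra.trace ℚ_[p] (RescaledCompletion K p w hw)) ∧
        (1 : RescaledCompletion K p w hw) ∈ ℚ_[p] ∙ y (Sum.inl 0))) := by
  have h5 := five_le_localDeg_of_mem_S_pilotDataOfK D hS
  have hp2 := residueChar_ne_two_of_mem_S_pilotDataOfK D hS hw
  obtain ⟨-, heven, hodd⟩ := baseLine_census_of_jannsenWingberg w hJW hJW₁ p hw hp2
  exact ⟨by omega, heven, fun ho => hodd ho ((show 3 ≤ 5 by norm_num).trans h5)⟩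

/-! ## 5. The unit-level companion at the bad places -/

/-- **THE `p`-ADIC UNITS `μ·ℤ_p^× ⊆ 𝒪_w^×` AT A BAD PLACE** — the level print's (Ind1) speaks about (`O^×(G_w)^{G_w}`, THE equivariant lift):
* `[K_w : ℚ_p]` EVEN (modulo `JannsenWingbergTwistsFirst`): some `φ ∈ Aut_top(G_w)` has `liftUnits φ (μ·ℤ_p^×) ∩ μ·ℤ_p^× ⊆ μ` (gen 12, Kondo
  Lemma 2.5 (2) / Hoshi Lemma 3.1 (v));
* `[K_w : ℚ_p]` ODD (modulo `JannsenWingbergTwists`): the same OR the residual branch (gen 13, part c).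
[claim: Mochizuki2012, status: disputed] [cite: Kondo2025OuterAutMLF, §2 Lemma 2.5 (2), Remark p.12]
[cite: Hoshi2024IntrinsicHodgeTate, Lemma 3.1 (v) pp.10–11] -/
theorem liftUnits_padic_at_bad_of_jannsenWingberg (hJW : JannsenWingbergTwists) (hJW₁ : JannsenWingbergTwistsFirst)
    {w : HeightOneSpectrum (𝓞 K)} (hS : w ∈ (pilotDataOfK D K).S)
    (p : ℕ) [Fact p.Prime] (hw : ((p : ℕ) : 𝓞 K) ∈ w.asIdeal) :
    (Even (localDeg K w) →
      ∃ φ : Gal w ≃ₜ* Gal w, ∀ u : (↥(w.adicCompletionIntegers K))ˣ,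
        RescaledCompletion.of K p w hw (galoisLog w (Additive.ofMul u)) ∈ Set.range (algebraMap ℚ_[p] (RescaledCompletion K p w hw)) →
        RescaledCompletion.of K p w hw (galoisLog w (Additive.ofMul (liftUnits w φ u))) ∈
          Set.range (algebraMap ℚ_[p] (RescaledCompletion K p w hw)) →
        IsOfFinOrder u) ∧
    (Odd (localDeg K w) →
      (∃ φ : Gal w ≃ₜ* Gal w, ∀ u : (↥(w.adicCompletionIntegers K))ˣ,
        RescaledCompletion.of K p w hw (galoisLog w (Additive.ofMul u)) ∈ Set.range (algebraMap ℚ_[p] (RescaledCompletion K p w hw)) →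
        RescaledCompletion.of K p w hw (galoisLog w (Additive.ofMul (liftUnits w φ u))) ∈
          Set.range (algebraMap ℚ_[p] (RescaledCompletion K p w hw)) →
        IsOfFinOrder u) ∨
      (∃ (g : ℕ) (_ : localDeg K w = 1 + 2 * g) (y : Module.Basis (Fin 1 ⊕ Fin g × Fin 2) ℚ_[p] (RescaledCompletion K p w hw))
        (ψ ψ' : Fin g → (w.adicCompletion K ≃+ w.adicCompletion K)),
        (∀ i, ψ i ∈ ind1StripOf w (galoisLog w)) ∧ (∀ i, ψ' i ∈ ind1StripOf w (galoisLog w)) ∧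
        (∀ i (x : RescaledCompletion K p w hw),
          RescaledCompletion.of K p w hw (ψ i ((RescaledCompletion.of K p w hw).symm x)) =
            x + y.coord (Sum.inr (i, 1)) x • y (Sum.inr (i, 0))) ∧
        (∀ i (x : RescaledCompletion K p w hw),
          RescaledCompletion.of K p w hw (ψ' i ((RescaledCompletion.of K p w hw).symm x)) =
            x - y.coord (Sum.inr (i, 0)) x • y (Sum.inr (i, 1))) ∧
        Submodule.span ℚ_[p] (Set.range fun iε : Fin g × Fin 2 => y (Sum.inr iε)) =
          LinearMap.ker (Algebra.trace ℚ_[p] (RescaledCompletion K p w hw)) ∧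
        (1 : RescaledCompletion K p w hw) ∈ ℚ_[p] ∙ y (Sum.inl 0))) := by
  have h5 := five_le_localDeg_of_mem_S_pilotDataOfK D hS
  have hp2 := residueChar_ne_two_of_mem_S_pilotDataOfK D hS hw
  refine ⟨fun hev => ?_, fun ho => ?_⟩
  · exact exists_liftUnits_padic_inter_padic_subset_torsion_of_jannsenWingbergFirst w hJW₁ p hw hp2
      ((show 2 ≤ 5 by norm_num).trans h5) hev
  · exact exists_liftUnits_padic_inter_padic_subset_torsion_or_residual_of_jannsenWingberg_odd w hJW p hw hp2
      ((show 3 ≤ 5 by norm_num).trans h5) ho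

end Summit.ABC.IUTFork.Thm311.Real

end
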